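import Literature.Probability.RandomPlanarGeometry.YangBaxterSAWComplex
import Mathlib.Data.List.TakeWhile
import HarnessLib

/-!
# The gluing argument of the Yang–Baxter transformation (Glazman–Manolescu, Corollary 3.2)

Topic `Literature/Probability/RandomPlanarGeometry`; second support file for the discharge of the
named fact `Literature.Probability.RandomPlanarGeometry.SAW.YangBaxter.GlazmanManolescu2019_prop42`
(`YangBaxterSAWTwoPoint.lean`): A. Glazman, I. Manolescu, *Self-avoiding walk on `ℤ²` with
Yang–Baxter weights: universality of critical fugacity and 2-point function*, Ann. Inst. Henri
Poincaré Probab. Stat. 56 (2020), arXiv:1708.00395 (`GlazmanManolescu2019`), **Corollary 3.2**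
(p. 9): "Let `Ω` be a rhombic tiling containing a hexagon `H` formed of three rhombi … Denote by
`Ω'` the tiling that coincides with `Ω` everywhere except for `H`, where the three rhombi are
rearranged as `H'`. Then, for any two vertices `a, b` of `Ω` that are not in `H ∖ ∂H`,
`Σ_{γ ⊂ Ω: a → b} w_Ω(γ) = Σ_{γ ⊂ Ω': a → b} w_{Ω'}(γ)`", whose printed proof is a sketch: "Write
the sums as double sums. First sum over all possible configurations outside `H` (and `H'`
respectively), then over those inside `H` (or `H'`) which lead to a single path connecting `a` to
`b`. The inside sum on the right and left hand side is equal due to Proposition 3.1 [the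
Yang–Baxter equation]; the outside weights are equal in `Ω` and `Ω'`."

This file PROVES the substitution principle behind this sketch for the rhombic complexes `Cx` of
`YangBaxterSAWComplex.lean`, for an arbitrary finite piece `H` (a `Cx.SubCx`: faces `H`, interior
edges `IntH`, boundary edges `BdH = ∂H`): `Cx.wsum_eq_of_Zloc_eq` — two lawful complexes on the
same faces and edges that agree outside `H` and have the same local partition functions
`Z_H(P) = Cx.Zloc H IntH P` (for the lists `P` of pairs of boundary edges arising from walks)
have the same `G_D(a, z)` for `a, z ∉ IntH`. The Yang–Baxter equation itself (the equality of the
`Zloc`'s of the two hexagons) is the object of the next file.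

## The double sum, made precise

* The **skeleton** of a walk (`Cx.skel`) is its edge list with the interior edges of `H` deleted;
  its consecutive pairs are either **gaps** (`Cx.gaps`: two boundary edges of `H`, joined by a
  piece of walk inside `H` — possibly a single arc) or **outside arcs** (`Cx.outPairs`). Here we use
  that no rhombus outside `H` has two edges of `∂H` as sides (`Cx.SubCx.bd_outside`), so that two
  consecutive boundary edges are always joined inside `H`.
* Conversely a skeleton `o` and a family `κ` of interior edge-lists, one per gap, give the edge list
  `Cx.fill o κ`; every walk is `fill` of its skeleton (`Cx.exists_fill_skel_eq`), injectively in
  `κ` (`Cx.fill_injective`), the arcs of `fill o κ` are the outside arcs and the inside arcs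
  (`Cx.mem_pairsOf_fill_iff`, `Cx.pairsOf_fill`).
* **Validity splits** (`Cx.isWalk_fill_iff`): `fill o κ` is a walk iff `o` satisfies the outside
  condition `Cx.OutValid` (the clauses of `Cx.IsWalk` on outside arcs, plus: no two consecutive
  gaps — a boundary edge borders one face of `H` only — and consecutive outside arcs in different
  faces) and `κ` is locally admissible (`Cx.LocValid` of `YangBaxterSAWComplex.lean`). The only
  non-local clause, "consecutive arcs lie in different rhombi", splits because inside arcs lie in
  faces of `H` and outside arcs do not (`Cx.isChain_pairsOf_fill_iff`).
* **The weight factorises** (`Cx.weight_fill`) as `w_out(o) · w_H(κ)` (`Cx.wOut`, `Cx.wLoc`), so the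
  walks with skeleton `o` weigh `w_out(o) · Z_H(gaps o)` (`Cx.sum_fibre_eq`) and
  `G_D(a, z) = Σ_o w_out(o) Z_H(gaps o)` (`Cx.wsum_eq_sum_skel`); the outside data do not depend on
  the complex inside `H` (`Cx.OutValid.of_agree`, `Cx.wOut_eq_of_agree`), whence Corollary 3.2.
-/

noncomputable section

open Real

namespace Literature.Probability.RandomPlanarGeometry.SAW.YangBaxter

/-! ## The gluing argument (Corollary 3.2)

"Write the sums in (3.1) as double sums. First sum over all possible configurations outside `H`
(and `H'` respectively), then over those inside `H` (or `H'`) which lead to a single path connecting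
`a` to `b`. The inside sum on the right and left hand side is equal due to Proposition 3.1; the
outside weights are equal in `Ω` and `Ω'`, since the two tilings are identical outside `H` and `H'`,
respectively." We organise this as follows: the *skeleton* of a walk is its edge list with the
interior edges of `H` deleted (`Cx.skel`); consecutive boundary edges of `H` in the skeleton are the
*gaps* (`Cx.gaps`), filled by the pieces of walk inside `H`; every walk is `Cx.fill` of its skeleton
by a locally admissible family (`Cx.LocValid`), validity splits into an outside condition on the
skeleton (`Cx.OutValid`) and the local condition, and the weight factorises
(`Cx.weight_fill`), whence `G_D(a,z) = Σ_{skeletons} w_out · Z_H(gaps)` (`Cx.wsum_eq_sum_skel`) and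
Corollary 3.2 (`Cx.wsum_eq_of_Zloc_eq`).
-/

namespace Cx

section Gluing

variable {F E : Type*} [DecidableEq F] [DecidableEq E]

/-! ### Skeletons, gaps, outside arcs, filling -/

section Skeleton

variable (IntH BdH : Finset E)

/-- **The skeleton** of an edge list: the interior edges of `H` deleted. [cite: GlazmanManolescu2019, Corollary 3.2 (proof)] -/
def skel (m : List E) : List E := m.filter fun e => e ∉ IntH

/-- **The gaps** of a skeleton: its consecutive pairs of boundary edges of `H` (the pairs of points
of `∂H` joined by a piece of walk inside `H`), in order. [cite: GlazmanManolescu2019, Corollary 3.2 (proof)] -/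
def gaps : List E → List (E × E)
  | e :: e' :: o => if e ∈ BdH ∧ e' ∈ BdH then (e, e') :: gaps (e' :: o) else gaps (e' :: o)
  | _ => []

/-- **The outside arcs** of a skeleton: its other consecutive pairs. [cite: GlazmanManolescu2019, Corollary 3.2 (proof)] -/
def outPairs : List E → List (E × E)
  | e :: e' :: o => if e ∈ BdH ∧ e' ∈ BdH then outPairs (e' :: o) else (e, e') :: outPairs (e' :: o)
  | _ => []

/-- **Filling the gaps** of a skeleton with interior edge-lists, one per gap, in order.
[cite: GlazmanManolescu2019, Corollary 3.2 (proof)] -/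
def fill : List E → List (List E) → List E
  | e :: e' :: o, κ =>
    if e ∈ BdH ∧ e' ∈ BdH then e :: (κ.headD [] ++ fill (e' :: o) κ.tail) else e :: fill (e' :: o) κ
  | o, _ => o

/-- The segments of a filled skeleton, in order: outside arcs `[e, e']` and inside runs
`e :: b ++ [e']`. [cite: GlazmanManolescu2019, Corollary 3.2 (proof)] -/
def runs : List E → List (List E) → List (List E)
  | e :: e' :: o, κ =>
    if e ∈ BdH ∧ e' ∈ BdH then (e :: (κ.headD [] ++ [e'])) :: runs (e' :: o) κ.tail
    else [e, e'] :: runs (e' :: o) κ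
  | _, _ => []

variable {IntH BdH}

/-- `gaps`, recursion. [folklore] -/
theorem gaps_cons_cons (e e' : E) (o : List E) :
    gaps BdH (e :: e' :: o) = if e ∈ BdH ∧ e' ∈ BdH then (e, e') :: gaps BdH (e' :: o) else gaps BdH (e' :: o) := rfl

/-- `outPairs`, recursion. [folklore] -/
theorem outPairs_cons_cons (e e' : E) (o : List E) :
    outPairs BdH (e :: e' :: o) =
      if e ∈ BdH ∧ e' ∈ BdH then outPairs BdH (e' :: o) else (e, e') :: outPairs BdH (e' :: o) := rfl

/-- `fill`, recursion. [folklore] -/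
theorem fill_cons_cons (e e' : E) (o : List E) (κ : List (List E)) :
    fill BdH (e :: e' :: o) κ = if e ∈ BdH ∧ e' ∈ BdH then e :: (κ.headD [] ++ fill BdH (e' :: o) κ.tail)
      else e :: fill BdH (e' :: o) κ := rfl

/-- `runs`, recursion. [folklore] -/
theorem runs_cons_cons (e e' : E) (o : List E) (κ : List (List E)) :
    runs BdH (e :: e' :: o) κ = if e ∈ BdH ∧ e' ∈ BdH then (e :: (κ.headD [] ++ [e'])) :: runs BdH (e' :: o) κ.tail
      else [e, e'] :: runs BdH (e' :: o) κ := rfl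

/-- `fill` of a singleton. [folklore] -/
@[simp] theorem fill_singleton (e : E) (κ : List (List E)) : fill BdH [e] κ = [e] := rfl

/-- `fill` of the empty skeleton. [folklore] -/
@[simp] theorem fill_nil (κ : List (List E)) : fill BdH ([] : List E) κ = [] := rfl

/-- `gaps` of the empty skeleton. [folklore] -/
@[simp] theorem gaps_nil : gaps BdH ([] : List E) = [] := rfl

/-- `gaps` of a singleton. [folklore] -/
@[simp] theorem gaps_singleton (e : E) : gaps BdH [e] = [] := rfl

/-- `outPairs` of the empty skeleton. [folklore] -/
@[simp] theorem outPairs_nil : outPairs BdH ([] : List E) = [] := rfl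

/-- `outPairs` of a singleton. [folklore] -/
@[simp] theorem outPairs_singleton (e : E) : outPairs BdH [e] = [] := rfl

/-- `runs` of the empty skeleton. [folklore] -/
@[simp] theorem runs_nil (κ : List (List E)) : runs BdH ([] : List E) κ = [] := rfl

/-- `runs` of a singleton. [folklore] -/
@[simp] theorem runs_singleton (e : E) (κ : List (List E)) : runs BdH [e] κ = [] := rfl

/-- The outside arcs are consecutive pairs of the skeleton. [folklore] -/
theorem outPairs_subset (o : List E) : outPairs BdH o ⊆ pairsOf o := by
  induction o with
  | nil => simp [outPairs]
  | cons e o ih =>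
    cases o with
    | nil => simp [outPairs]
    | cons e' o =>
      rw [outPairs_cons_cons, pairsOf_cons_cons]
      split_ifs
      · exact fun p hp => List.mem_cons_of_mem _ (ih hp)
      · exact List.cons_subset_cons _ ih

/-- The gaps are consecutive pairs of the skeleton. [folklore] -/
theorem gaps_subset (o : List E) : gaps BdH o ⊆ pairsOf o := by
  induction o with
  | nil => simp [gaps]
  | cons e o ih =>
    cases o with
    | nil => simp [gaps]
    | cons e' o =>
      rw [gaps_cons_cons, pairsOf_cons_cons]
      split_ifs
      · exact List.cons_subset_cons _ ih
      · exact fun p hp => List.mem_cons_of_mem _ (ih hp)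

/-- The gaps are pairs of boundary edges. [folklore] -/
theorem mem_of_mem_gaps {o : List E} {p : E × E} (hp : p ∈ gaps BdH o) : p.1 ∈ BdH ∧ p.2 ∈ BdH := by
  induction o with
  | nil => simp [gaps] at hp
  | cons e o ih =>
    cases o with
    | nil => simp [gaps] at hp
    | cons e' o =>
      rw [gaps_cons_cons] at hp
      split_ifs at hp with h
      · rcases List.mem_cons.1 hp with rfl | hp
        · exact h
        · exact ih hp
      · exact ih hp

/-- The outside arcs are not pairs of boundary edges. [folklore] -/
theorem not_gap_of_mem_outPairs {o : List E} {p : E × E} (hp : p ∈ outPairs BdH o) : ¬(p.1 ∈ BdH ∧ p.2 ∈ BdH) := by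
  induction o with
  | nil => simp [outPairs] at hp
  | cons e o ih =>
    cases o with
    | nil => simp [outPairs] at hp
    | cons e' o =>
      rw [outPairs_cons_cons] at hp
      split_ifs at hp with h
      · exact ih hp
      · rcases List.mem_cons.1 hp with rfl | hp
        · exact h
        · exact ih hp

/-- A consecutive pair of the skeleton is a gap or an outside arc. [folklore] -/
theorem mem_gaps_or_mem_outPairs {o : List E} {p : E × E} (hp : p ∈ pairsOf o) :
    p ∈ gaps BdH o ∨ p ∈ outPairs BdH o := by
  induction o with
  | nil => simp at hp
  | cons e o ih =>
    cases o with
    | nil => simp at hp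
    | cons e' o =>
      rw [gaps_cons_cons, outPairs_cons_cons]
      rw [pairsOf_cons_cons, List.mem_cons] at hp
      rcases hp with rfl | hp
      · split_ifs
        · exact Or.inl List.mem_cons_self
        · exact Or.inr List.mem_cons_self
      · rcases ih hp with h | h
        · split_ifs
          · exact Or.inl (List.mem_cons_of_mem _ h)
          · exact Or.inl h
        · split_ifs
          · exact Or.inr h
          · exact Or.inr (List.mem_cons_of_mem _ h)

/-- A filled skeleton starts like the skeleton. [folklore] -/
theorem fill_cons (e : E) (o : List E) (κ : List (List E)) : ∃ t, fill BdH (e :: o) κ = e :: t := by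
  cases o with
  | nil => exact ⟨[], rfl⟩
  | cons e' o => rw [fill_cons_cons]; split_ifs <;> exact ⟨_, rfl⟩

/-- The head of a filled skeleton. [folklore] -/
theorem head?_fill (o : List E) (κ : List (List E)) : (fill BdH o κ).head? = o.head? := by
  cases o with
  | nil => rfl
  | cons e o => obtain ⟨t, ht⟩ := fill_cons (BdH := BdH) e o κ; rw [ht]; rfl

/-- A filled nonempty skeleton is nonempty. [folklore] -/
theorem fill_ne_nil {o : List E} (ho : o ≠ []) (κ : List (List E)) : fill BdH o κ ≠ [] := by
  obtain ⟨e, o, rfl⟩ := List.exists_cons_of_ne_nil ho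
  obtain ⟨t, ht⟩ := fill_cons (BdH := BdH) e o κ
  rw [ht]; exact List.cons_ne_nil _ _

/-- The last element of a filled skeleton. [folklore] -/
theorem getLast?_fill (o : List E) (κ : List (List E)) : (fill BdH o κ).getLast? = o.getLast? := by
  induction o generalizing κ with
  | nil => rfl
  | cons e o ih =>
    cases o with
    | nil => rfl
    | cons e' o =>
      rw [fill_cons_cons]
      split_ifs
      · simp [List.getLast?_cons, List.getLast?_append, ih]
      · simp [List.getLast?_cons, ih]

/-- **The arcs of a filled skeleton are those of its segments.** [folklore] -/
theorem pairsOf_fill (o : List E) (κ : List (List E)) :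
    pairsOf (fill BdH o κ) = (runs BdH o κ).flatMap pairsOf := by
  induction o generalizing κ with
  | nil => rfl
  | cons e o ih =>
    cases o with
    | nil => rfl
    | cons e' o =>
      rw [fill_cons_cons, runs_cons_cons]
      split_ifs with hg
      · obtain ⟨t, ht⟩ := fill_cons (BdH := BdH) e' o κ.tail
        rw [List.flatMap_cons, ← ih κ.tail, ht]
        have h1 : e :: (κ.headD [] ++ e' :: t) = (e :: (κ.headD [] ++ [e'])) ++ t := by simp
        rw [h1]
        rcases eq_or_ne t [] with rfl | hne
        · simp
        · rw [pairsOf_append (List.cons_ne_nil _ _) hne, pairsOf_cons_of_ne_nil e' hne]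
          congr 2
          simp [List.getLast_append_of_ne_nil]
      · obtain ⟨t, ht⟩ := fill_cons (BdH := BdH) e' o κ
        rw [List.flatMap_cons, ← ih κ, ht]
        rfl

omit [DecidableEq E] in
/-- `insideRuns`, recursion. [folklore] -/
theorem insideRuns_cons (xy : E × E) (P : List (E × E)) (b : List E) (κ : List (List E)) :
    insideRuns (xy :: P) (b :: κ) = (xy.1 :: (b ++ [xy.2])) :: insideRuns P κ := rfl

omit [DecidableEq E] in
/-- `insidePairs`, recursion. [folklore] -/
theorem insidePairs_cons (xy : E × E) (P : List (E × E)) (b : List E) (κ : List (List E)) :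
    insidePairs (xy :: P) (b :: κ) = pairsOf (xy.1 :: (b ++ [xy.2])) ++ insidePairs P κ := by
  rw [insidePairs, insideRuns_cons, List.flatMap_cons]; rfl

omit [DecidableEq E] in
/-- No inside runs without gaps. [folklore] -/
@[simp] theorem insideRuns_nil_left (κ : List (List E)) : insideRuns ([] : List (E × E)) κ = [] := rfl

omit [DecidableEq E] in
/-- No inside arcs without gaps. [folklore] -/
@[simp] theorem insidePairs_nil_left (κ : List (List E)) : insidePairs ([] : List (E × E)) κ = [] := rfl

/-- A family with one list per gap of `e :: e' :: o`, `(e, e')` a gap, is `b :: κ'` with `κ'` a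
family for the gaps of `e' :: o`. [folklore] -/
theorem exists_cons_of_length_eq_gaps {e e' : E} {o : List E} {κ : List (List E)} (hg : e ∈ BdH ∧ e' ∈ BdH)
    (hlen : κ.length = (gaps BdH (e :: e' :: o)).length) :
    ∃ b κ', κ = b :: κ' ∧ κ'.length = (gaps BdH (e' :: o)).length := by
  rw [gaps_cons_cons, if_pos hg, List.length_cons] at hlen
  obtain ⟨b, κ', rfl⟩ := List.exists_cons_of_length_eq_add_one hlen
  exact ⟨b, κ', rfl, by simpa using hlen⟩

/-- **The arcs of a filled skeleton: the outside arcs and the inside arcs** (as a set).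
[cite: GlazmanManolescu2019, Corollary 3.2 (proof)] -/
theorem mem_pairsOf_fill_iff {o : List E} {κ : List (List E)} (hlen : κ.length = (gaps BdH o).length)
    {p : E × E} : p ∈ pairsOf (fill BdH o κ) ↔ p ∈ outPairs BdH o ∨ p ∈ insidePairs (gaps BdH o) κ := by
  rw [pairsOf_fill]
  induction o generalizing κ with
  | nil => simp [runs, outPairs, gaps]
  | cons e o ih =>
    cases o with
    | nil => simp [runs, outPairs, gaps]
    | cons e' o =>
      rw [runs_cons_cons, outPairs_cons_cons]
      by_cases hg : e ∈ BdH ∧ e' ∈ BdH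
      · obtain ⟨b, κ', rfl, hlen'⟩ := exists_cons_of_length_eq_gaps hg hlen
        rw [if_pos hg, if_pos hg, gaps_cons_cons, if_pos hg, insidePairs_cons, List.flatMap_cons, List.mem_append,
          List.mem_append, List.headD_cons, List.tail_cons, ih hlen']
        tauto
      · rw [gaps_cons_cons, if_neg hg] at hlen
        rw [if_neg hg, if_neg hg, gaps_cons_cons, if_neg hg, List.flatMap_cons, List.mem_append, ih hlen,
          List.mem_cons]
        simp only [pairsOf_cons_cons, pairsOf_singleton, List.mem_singleton]
        tauto

/-- The arcs of a filled skeleton, filtered by a function killing the inside arcs, in order: the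
outside arcs. [folklore] -/
theorem filterMap_pairsOf_fill_of_inside_eq_none {β : Type*} (g : E × E → Option β) {o : List E}
    {κ : List (List E)} (hlen : κ.length = (gaps BdH o).length)
    (hg : ∀ p ∈ insidePairs (gaps BdH o) κ, g p = none) :
    (pairsOf (fill BdH o κ)).filterMap g = (outPairs BdH o).filterMap g := by
  rw [pairsOf_fill]
  induction o generalizing κ with
  | nil => simp [runs, outPairs]
  | cons e o ih =>
    cases o with
    | nil => simp [runs, outPairs]
    | cons e' o =>
      rw [runs_cons_cons, outPairs_cons_cons]
      by_cases hge : e ∈ BdH ∧ e' ∈ BdH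
      · obtain ⟨b, κ', rfl, hlen'⟩ := exists_cons_of_length_eq_gaps hge hlen
        rw [gaps_cons_cons, if_pos hge, insidePairs_cons] at hg
        rw [if_pos hge, if_pos hge, List.flatMap_cons, List.filterMap_append, List.headD_cons, List.tail_cons,
          ih hlen' fun p hp => hg p (List.mem_append_right _ hp)]
        rw [List.filterMap_eq_nil_iff.2 fun p hp => hg p (List.mem_append_left _ hp), List.nil_append]
      · rw [gaps_cons_cons, if_neg hge] at hlen hg
        rw [if_neg hge, if_neg hge, List.flatMap_cons, List.filterMap_append, ih hlen hg,
          show (e, e') :: outPairs BdH (e' :: o) = [(e, e')] ++ outPairs BdH (e' :: o) from rfl, List.filterMap_append]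
        rfl

/-- The arcs of a filled skeleton, filtered by a function killing the outside arcs, in order: the
inside arcs. [folklore] -/
theorem filterMap_pairsOf_fill_of_outside_eq_none {β : Type*} (g : E × E → Option β) {o : List E}
    {κ : List (List E)} (hlen : κ.length = (gaps BdH o).length)
    (hg : ∀ p ∈ outPairs BdH o, g p = none) :
    (pairsOf (fill BdH o κ)).filterMap g = (insidePairs (gaps BdH o) κ).filterMap g := by
  rw [pairsOf_fill]
  induction o generalizing κ with
  | nil => simp [runs, gaps]
  | cons e o ih =>
    cases o with
    | nil => simp [runs, gaps]
    | cons e' o =>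
      rw [runs_cons_cons, gaps_cons_cons]
      by_cases hge : e ∈ BdH ∧ e' ∈ BdH
      · obtain ⟨b, κ', rfl, hlen'⟩ := exists_cons_of_length_eq_gaps hge hlen
        rw [outPairs_cons_cons, if_pos hge] at hg
        rw [if_pos hge, if_pos hge, List.flatMap_cons, List.filterMap_append, List.headD_cons, List.tail_cons,
          ih hlen' hg, insidePairs_cons, List.filterMap_append]
      · rw [gaps_cons_cons, if_neg hge] at hlen
        rw [outPairs_cons_cons, if_neg hge] at hg
        rw [if_neg hge, if_neg hge, List.flatMap_cons, List.filterMap_append,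
          ih hlen fun p hp => hg p (List.mem_cons_of_mem _ hp)]
        rw [List.filterMap_eq_nil_iff.2 (by simpa using hg (e, e') List.mem_cons_self), List.nil_append]

/-- **A filled skeleton is a rearrangement of the skeleton and the inserted edges.** [folklore] -/
theorem fill_perm {o : List E} {κ : List (List E)} (hlen : κ.length = (gaps BdH o).length) :
    (fill BdH o κ).Perm (o ++ κ.flatten) := by
  induction o generalizing κ with
  | nil =>
    obtain rfl : κ = [] := List.eq_nil_of_length_eq_zero (by simpa using hlen)
    exact List.Perm.refl _
  | cons e o ih =>
    cases o with
    | nil =>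
      obtain rfl : κ = [] := List.eq_nil_of_length_eq_zero (by simpa using hlen)
      exact List.Perm.refl _
    | cons e' o =>
      rw [fill_cons_cons]
      by_cases hg : e ∈ BdH ∧ e' ∈ BdH
      · obtain ⟨b, κ', rfl, hlen'⟩ := exists_cons_of_length_eq_gaps hg hlen
        rw [if_pos hg, List.headD_cons, List.tail_cons, List.flatten_cons]
        refine List.Perm.cons e ?_
        refine ((ih hlen').append_left b).trans ?_
        refine List.perm_append_comm.trans ?_
        rw [List.cons_append, List.cons_append, List.append_assoc]
        exact ((List.perm_append_comm (l₁ := κ'.flatten) (l₂ := b)).append_left o).cons e'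
      · rw [gaps_cons_cons, if_neg hg] at hlen
        rw [if_neg hg]
        exact (ih hlen).cons e

/-- **The skeleton of a filled skeleton is the skeleton**, if the skeleton avoids the interior
edges and the inserted lists consist of interior edges. [folklore] -/
theorem skel_fill {o : List E} (ho : ∀ e ∈ o, e ∉ IntH) {κ : List (List E)}
    (hκ : ∀ b ∈ κ, ∀ e ∈ b, e ∈ IntH) (hlen : κ.length = (gaps BdH o).length) :
    skel IntH (fill BdH o κ) = o := by
  induction o generalizing κ with
  | nil => rfl
  | cons e o ih =>
    cases o with
    | nil => simpa [skel] using ho e (by simp)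
    | cons e' o =>
      have he : e ∉ IntH := ho e (by simp)
      rw [fill_cons_cons]
      by_cases hg : e ∈ BdH ∧ e' ∈ BdH
      · obtain ⟨b, κ', rfl, hlen'⟩ := exists_cons_of_length_eq_gaps hg hlen
        rw [if_pos hg, List.headD_cons, List.tail_cons, skel, List.filter_cons_of_pos (by simpa using he),
          List.filter_append, List.filter_eq_nil_iff.2 fun x hx => by simpa using hκ b (by simp) x hx,
          List.nil_append]
        exact congrArg _ (ih (fun x hx => ho x (List.mem_cons_of_mem _ hx)) (fun b' hb' => hκ b' (by simp [hb'])) hlen')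
      · rw [gaps_cons_cons, if_neg hg] at hlen
        rw [if_neg hg, skel, List.filter_cons_of_pos (by simpa using he)]
        exact congrArg _ (ih (fun x hx => ho x (List.mem_cons_of_mem _ hx)) hκ hlen)

/-- **`fill o` is injective** on families of interior edge-lists with one list per gap. [folklore] -/
theorem fill_injective {o : List E} (ho : ∀ e ∈ o, e ∉ IntH) {κ₁ κ₂ : List (List E)}
    (h₁ : ∀ b ∈ κ₁, ∀ e ∈ b, e ∈ IntH) (hl₁ : κ₁.length = (gaps BdH o).length)
    (h₂ : ∀ b ∈ κ₂, ∀ e ∈ b, e ∈ IntH) (hl₂ : κ₂.length = (gaps BdH o).length)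
    (h : fill BdH o κ₁ = fill BdH o κ₂) : κ₁ = κ₂ := by
  induction o generalizing κ₁ κ₂ with
  | nil =>
    obtain rfl : κ₁ = [] := List.eq_nil_of_length_eq_zero (by simpa using hl₁)
    obtain rfl : κ₂ = [] := List.eq_nil_of_length_eq_zero (by simpa using hl₂)
    rfl
  | cons e o ih =>
    cases o with
    | nil =>
      obtain rfl : κ₁ = [] := List.eq_nil_of_length_eq_zero (by simpa using hl₁)
      obtain rfl : κ₂ = [] := List.eq_nil_of_length_eq_zero (by simpa using hl₂)
      rfl
    | cons e' o =>
      have he' : e' ∉ IntH := ho e' (by simp)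
      rw [fill_cons_cons, fill_cons_cons] at h
      by_cases hg : e ∈ BdH ∧ e' ∈ BdH
      · obtain ⟨b₁, κ₁', rfl, hl₁'⟩ := exists_cons_of_length_eq_gaps hg hl₁
        obtain ⟨b₂, κ₂', rfl, hl₂'⟩ := exists_cons_of_length_eq_gaps hg hl₂
        rw [if_pos hg, if_pos hg] at h
        simp only [List.headD_cons, List.tail_cons, List.cons.injEq, true_and] at h
        obtain ⟨t₁, ht₁⟩ := fill_cons (BdH := BdH) e' o κ₁'
        obtain ⟨t₂, ht₂⟩ := fill_cons (BdH := BdH) e' o κ₂'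
        have hb : b₁ = b₂ := by
          have := congrArg (List.takeWhile fun x => decide (x ∈ IntH)) h
          rwa [ht₁, ht₂, List.takeWhile_append_of_pos (fun x hx => by simpa using h₁ b₁ (by simp) x hx),
            List.takeWhile_append_of_pos (fun x hx => by simpa using h₂ b₂ (by simp) x hx),
            List.takeWhile_cons_of_neg (by simpa using he'), List.takeWhile_cons_of_neg (by simpa using he'),
            List.append_nil, List.append_nil] at this
        subst hb
        rw [ih (fun x hx => ho x (List.mem_cons_of_mem _ hx)) (fun b hb => h₁ b (by simp [hb])) hl₁'
          (fun b hb => h₂ b (by simp [hb])) hl₂' (List.append_cancel_left h)]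
      · rw [gaps_cons_cons, if_neg hg] at hl₁ hl₂
        rw [if_neg hg, if_neg hg, List.cons.injEq] at h
        exact ih (fun x hx => ho x (List.mem_cons_of_mem _ hx)) h₁ hl₁ h₂ hl₂ h.2

/-- **Every suitable edge list is a filled skeleton**: if the first and last edges are not interior
and interior edges are only adjacent to interior or boundary edges, the list is `fill` of its
skeleton by a family of interior lists, one per gap. [cite: GlazmanManolescu2019, Corollary 3.2 (proof)] -/
theorem exists_fill_eq :
    ∀ (n : ℕ) (m : List E), m.length ≤ n → (∀ e, m.head? = some e → e ∉ IntH) →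
      (∀ e, m.getLast? = some e → e ∉ IntH) →
      (∀ p ∈ pairsOf m, (p.1 ∈ IntH → p.2 ∈ IntH ∨ p.2 ∈ BdH) ∧ (p.2 ∈ IntH → p.1 ∈ IntH ∨ p.1 ∈ BdH)) →
      ∃ κ : List (List E), κ.length = (gaps BdH (skel IntH m)).length ∧ (∀ b ∈ κ, ∀ e ∈ b, e ∈ IntH) ∧
        fill BdH (skel IntH m) κ = m := by
  intro n
  induction n with
  | zero =>
    intro m hm _ _ _
    rw [List.eq_nil_of_length_eq_zero (Nat.le_zero.1 hm)]
    exact ⟨[], rfl, by simp, rfl⟩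
  | succ n ih =>
    intro m hm hhead hlast hadj
    cases m with
    | nil => exact ⟨[], rfl, by simp, rfl⟩
    | cons e m' =>
      have he : e ∉ IntH := hhead e rfl
      -- split off the maximal interior block after `e`
      set B := m'.takeWhile fun x => decide (x ∈ IntH) with hB
      set R := m'.dropWhile fun x => decide (x ∈ IntH) with hR
      have hBR : B ++ R = m' := List.takeWhile_append_dropWhile
      have hBint : ∀ x ∈ B, x ∈ IntH := fun x hx => by simpa using List.mem_takeWhile_imp hx
      have hskelB : skel IntH B = [] := List.filter_eq_nil_iff.2 fun x hx => by simpa using hBint x hx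
      cases hR' : R with
      | nil =>
        -- then `B = []` too (the last edge is not interior) and `m = [e]`
        rw [hR', List.append_nil] at hBR
        have hB0 : B = [] := by
          by_contra hne
          have hlastB := hlast (B.getLast hne) (by
            rw [← hBR, List.getLast?_cons, List.getLast?_eq_getLast_of_ne_nil hne]; rfl)
          exact hlastB (hBint _ (List.getLast_mem hne))
        rw [← hBR, hB0]
        have hsk : skel IntH [e] = [e] := by simp [skel, he]
        refine ⟨[], by rw [hsk]; rfl, by simp, by rw [hsk]; rfl⟩
      | cons e' R' =>
        have he' : e' ∉ IntH := by
          have := List.head_dropWhile_not (fun x => decide (x ∈ IntH)) (l := m') (by rw [← hR, hR']; simp)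
          simp only [← hR, hR', List.head_cons, decide_eq_false_iff_not] at this
          exact this
        -- the induction hypothesis for the suffix `e' :: R'`
        have hsuf : ∀ p ∈ pairsOf (e' :: R'), p ∈ pairsOf (e :: m') := by
          intro p hp
          rw [← hBR, hR', ← List.cons_append]
          rcases eq_or_ne B [] with hB0 | hB0
          · rw [hB0]; exact List.mem_cons_of_mem _ hp
          · rw [pairsOf_append (List.cons_ne_nil _ _) (List.cons_ne_nil _ _)]
            exact List.mem_append_right _ (List.mem_cons_of_mem _ hp)
        obtain ⟨κ', hlen', hκ', hfill'⟩ := ih (e' :: R') (by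
            have : (B ++ R).length = m'.length := by rw [hBR]
            rw [hR', List.length_append, List.length_cons] at this
            simp only [List.length_cons] at hm ⊢; omega)
          (fun x hx => by simp only [List.head?_cons, Option.some.injEq] at hx; exact hx ▸ he')
          (fun x hx => hlast x (by
            rw [← hBR, hR', ← List.cons_append, List.getLast?_append, hx]; rfl))
          (fun p hp => hadj p (hsuf p hp))
        have hskel : skel IntH (e :: m') = e :: skel IntH (e' :: R') := by
          rw [← hBR, hR', skel, List.filter_cons_of_pos (by simpa using he), List.filter_append]
          change e :: (skel IntH B ++ skel IntH (e' :: R')) = _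
          rw [hskelB, List.nil_append]
        have hskel' : ∃ s, skel IntH (e' :: R') = e' :: s :=
          ⟨skel IntH R', by rw [skel, List.filter_cons_of_pos (by simpa using he')]; rfl⟩
        obtain ⟨s, hs⟩ := hskel'
        rw [hskel, hs]
        rw [hs] at hfill' hlen'
        by_cases hg : e ∈ BdH ∧ e' ∈ BdH
        · refine ⟨B :: κ', ?_, ?_, ?_⟩
          · rw [gaps_cons_cons, if_pos hg, List.length_cons, List.length_cons, hlen']
          · intro b hb
            rcases List.mem_cons.1 hb with rfl | hb
            · exact hBint
            · exact hκ' b hb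
          · rw [fill_cons_cons, if_pos hg, List.headD_cons, List.tail_cons, hfill', ← hR', hBR]
        · -- no gap: then the interior block is empty
          have hB0 : B = [] := by
            by_contra hne
            obtain ⟨x, B', hxB⟩ := List.exists_cons_of_ne_nil hne
            apply hg
            constructor
            · have h1 := (hadj (e, x) (by rw [← hBR, hxB]; simp)).2 (hBint x (by simp [hxB]))
              exact h1.resolve_left he
            · have hmem : (B.getLast hne, e') ∈ pairsOf (e :: m') := by
                rw [← hBR, hR', ← List.cons_append, pairsOf_append (List.cons_ne_nil _ _) (List.cons_ne_nil _ _)]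
                refine List.mem_append_right _ ?_
                rw [List.getLast_cons hne]
                exact List.mem_cons_self
              have h2 := (hadj _ hmem).1 (hBint _ (List.getLast_mem hne))
              exact h2.resolve_left he'
          refine ⟨κ', ?_, hκ', ?_⟩
          · rw [gaps_cons_cons, if_neg hg, hlen']
          · rw [fill_cons_cons, if_neg hg, hfill', ← hR', ← hBR, hB0, List.nil_append]


/-! ### A general chain lemma -/

omit [DecidableEq F] [DecidableEq E] in
/-- Chains over a concatenation of nonempty blocks: chains inside the blocks and at the junctions.
[folklore] -/
theorem isChain_flatMap_iff {α β : Type*} {R : β → β → Prop} {f : α → List β} {L : List α}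
    (hne : ∀ a ∈ L, f a ≠ []) :
    (L.flatMap f).IsChain R ↔ (∀ a ∈ L, (f a).IsChain R) ∧
      L.IsChain fun a a' => ∀ x ∈ (f a).getLast?, ∀ y ∈ (f a').head?, R x y := by
  induction L with
  | nil => simp
  | cons a L ih =>
    rw [List.flatMap_cons, List.isChain_append, ih fun b hb => hne b (List.mem_cons_of_mem _ hb)]
    cases L with
    | nil => simp
    | cons a' L =>
      rw [List.isChain_cons_cons]
      have hne' : f a' ≠ [] := hne a' (by simp)
      simp only [List.mem_cons, forall_eq_or_imp, List.flatMap_cons, List.head?_append_of_ne_nil _ hne']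
      tauto

end Skeleton

/-! ### Sub-complexes, and the outside condition on skeletons -/

/-- **The hypotheses on the piece `H` to be re-tiled** (a hexagon of three rhombi in the
application): its faces are faces of the domain; its edges are split into interior edges `IntH`
(all of whose faces are in `H`) and boundary edges `BdH` (`∂H`, "the six edges of `H` shared by
only one rhombus" of `H`); and no rhombus outside `H` has two distinct edges of `∂H` as sides (true
for a hexagon inside a rhombic tiling). [cite: GlazmanManolescu2019, Proposition 3.1 and Corollary 3.2] -/
structure SubCx (K : Cx F E) (D : Set F) (H : Finset F) (IntH BdH : Finset E) : Prop where
  /-- `H ⊆ D` -/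
  subset : ∀ f ∈ H, f ∈ D
  /-- interior and boundary edges are distinct -/
  disjoint : ∀ e ∈ IntH, e ∉ BdH
  /-- every face bordering an interior edge is in `H` -/
  int_faces : ∀ e ∈ IntH, ∀ (f : F) (s : Side), K.side f s = e → f ∈ H
  /-- the sides of the faces of `H` are interior or boundary edges -/
  sides_mem : ∀ f ∈ H, ∀ s, K.side f s ∈ IntH ∨ K.side f s ∈ BdH
  /-- a boundary edge borders only one face of `H` -/
  bd_unique : ∀ e ∈ BdH, ∀ f ∈ H, ∀ f' ∈ H, (∃ s, K.side f s = e) → (∃ t, K.side f' t = e) → f = f'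
  /-- no face outside `H` has two distinct boundary edges as sides -/
  bd_outside : ∀ e ∈ BdH, ∀ e' ∈ BdH, e ≠ e' → ∀ f ∉ H, (∃ s, K.side f s = e) → (∃ t, K.side f t = e') → False

/-- **The outside condition** on a skeleton `o` (from `a` to `z`): the clauses of `Cx.IsWalk` that
concern the outside arcs only, plus "no two consecutive gaps" (a boundary edge borders only one
face of `H`, so a walk cannot re-enter `H` through the edge it just left by).
[cite: GlazmanManolescu2019, Corollary 3.2 (proof: "configurations outside H")] -/
structure OutValid (K : Cx F E) (D : Set F) (H : Finset F) (IntH BdH : Finset E) (a z : E) (o : List E) : Prop where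
  /-- the skeleton starts at `a` -/
  head_eq : o.head? = some a
  /-- the skeleton ends at `z` -/
  getLast_eq : o.getLast? = some z
  /-- no repeated edge -/
  nodup : o.Nodup
  /-- no interior edge -/
  not_mem : ∀ e ∈ o, e ∉ IntH
  /-- outside arcs are drawn in faces of `D` outside `H` -/
  arc_mem : ∀ p ∈ outPairs BdH o, ∃ f ∈ D, f ∉ H ∧ K.arcFace p = some f
  /-- no two consecutive gaps; consecutive outside arcs lie in different faces -/
  triple : (pairsOf o).IsChain fun p q =>
    ¬((p.1 ∈ BdH ∧ p.2 ∈ BdH) ∧ (q.1 ∈ BdH ∧ q.2 ∈ BdH)) ∧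
      (¬(p.1 ∈ BdH ∧ p.2 ∈ BdH) → ¬(q.1 ∈ BdH ∧ q.2 ∈ BdH) → K.arcFace p ≠ K.arcFace q)
  /-- no face outside `H` carries both straight arcs -/
  noncross : ∀ f ∉ H,
    ((K.side f .W, K.side f .E) ∈ outPairs BdH o ∨ (K.side f .E, K.side f .W) ∈ outPairs BdH o) →
      ¬((K.side f .S, K.side f .N) ∈ outPairs BdH o ∨ (K.side f .N, K.side f .S) ∈ outPairs BdH o)

section Split

variable {K : Cx F E} {D : Set F} {H : Finset F} {IntH BdH : Finset E}

omit [DecidableEq F] [DecidableEq E] in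
/-- The first components of the arcs of `l ++ [y]` are the elements of `l`. [folklore] -/
theorem fst_mem_of_mem_pairsOf_append_singleton {l : List E} {y : E} {p : E × E}
    (hp : p ∈ pairsOf (l ++ [y])) : p.1 ∈ l := by
  obtain ⟨i, hi, rfl⟩ := mem_pairsOf_iff.1 hp
  simp only [List.length_append, List.length_singleton] at hi
  simp only [List.getElem_append_left (show i < l.length by omega)]
  exact List.getElem_mem _

omit [DecidableEq F] [DecidableEq E] in
/-- The arcs of an inside run `x :: b ++ [y]`: they involve an inserted edge, or the run is the
single arc `(x, y)`. [folklore] -/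
theorem mem_pairsOf_run {x y : E} {b : List E} {p : E × E} (hp : p ∈ pairsOf (x :: (b ++ [y]))) :
    (p.1 ∈ b ∨ p.2 ∈ b) ∨ (b = [] ∧ p = (x, y)) := by
  cases b with
  | nil =>
    simp only [List.nil_append, pairsOf_cons_cons, pairsOf_singleton, List.mem_singleton] at hp
    exact Or.inr ⟨rfl, hp⟩
  | cons i b =>
    rw [List.cons_append, pairsOf_cons_cons, List.mem_cons] at hp
    rcases hp with rfl | hp
    · exact Or.inl (Or.inr (by simp))
    · rw [← List.cons_append] at hp
      exact Or.inl (Or.inl (fst_mem_of_mem_pairsOf_append_singleton hp))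

omit [DecidableEq F] [DecidableEq E] in
/-- The arcs of the inside runs come from the runs. [folklore] -/
theorem exists_of_mem_insidePairs {P : List (E × E)} {κ : List (List E)} {p : E × E}
    (hp : p ∈ insidePairs P κ) : ∃ xy ∈ P, ∃ b ∈ κ, p ∈ pairsOf (xy.1 :: (b ++ [xy.2])) := by
  induction P generalizing κ with
  | nil => simp at hp
  | cons xy P ih =>
    cases κ with
    | nil => simp [insidePairs, insideRuns] at hp
    | cons b κ =>
      rw [insidePairs_cons, List.mem_append] at hp
      rcases hp with hp | hp
      · exact ⟨xy, List.mem_cons_self, b, List.mem_cons_self, hp⟩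
      · obtain ⟨xy', hxy', b', hb', h⟩ := ih hp
        exact ⟨xy', List.mem_cons_of_mem _ hxy', b', List.mem_cons_of_mem _ hb', h⟩

omit [DecidableEq F] [DecidableEq E] in
/-- The inside runs come from the gaps and the family. [folklore] -/
theorem exists_of_mem_insideRuns {P : List (E × E)} {κ : List (List E)} {r : List E}
    (hr : r ∈ insideRuns P κ) : ∃ xy ∈ P, ∃ b ∈ κ, r = xy.1 :: (b ++ [xy.2]) := by
  induction P generalizing κ with
  | nil => simp at hr
  | cons xy P ih =>
    cases κ with
    | nil => simp [insideRuns] at hr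
    | cons b κ =>
      rw [insideRuns_cons, List.mem_cons] at hr
      rcases hr with rfl | hr
      · exact ⟨xy, List.mem_cons_self, b, List.mem_cons_self, rfl⟩
      · obtain ⟨xy', hxy', b', hb', h⟩ := ih hr
        exact ⟨xy', List.mem_cons_of_mem _ hxy', b', List.mem_cons_of_mem _ hb', h⟩

omit [DecidableEq F] in
/-- **The face of an inside arc is a face of `H`.** [cite: GlazmanManolescu2019, Corollary 3.2 (proof)] -/
theorem mem_H_of_insidePair (hS : K.SubCx D H IntH BdH) (hK : K.Lawful) {o : List E} {κ : List (List E)}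
    (hκ : ∀ b ∈ κ, ∀ e ∈ b, e ∈ IntH) {p : E × E} (hp : p ∈ insidePairs (gaps BdH o) κ) {f : F}
    (hf : K.arcFace p = some f) : f ∈ H := by
  obtain ⟨xy, hxy, b, hb, hp⟩ := exists_of_mem_insidePairs hp
  obtain ⟨hne, ⟨s, hs⟩, ⟨t, ht⟩⟩ := (hK.commonFace_eq_some_iff _ _ f).1 hf
  rcases mem_pairsOf_run hp with (h | h) | ⟨-, rfl⟩
  · exact hS.int_faces _ (hκ b hb _ h) f s hs
  · exact hS.int_faces _ (hκ b hb _ h) f t ht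
  · obtain ⟨hx, hy⟩ := mem_of_mem_gaps hxy
    by_contra hfH
    exact hS.bd_outside _ hx _ hy hne f hfH ⟨s, hs⟩ ⟨t, ht⟩

omit [DecidableEq F] in
/-- **The face of an outside arc is outside `H`.** [cite: GlazmanManolescu2019, Corollary 3.2 (proof)] -/
theorem not_mem_H_of_outPair (hS : K.SubCx D H IntH BdH) (hK : K.Lawful) {o : List E}
    (ho : ∀ e ∈ o, e ∉ IntH) {p : E × E} (hp : p ∈ outPairs BdH o) {f : F} (hf : K.arcFace p = some f) :
    f ∉ H := by
  intro hfH
  obtain ⟨-, ⟨s, hs⟩, ⟨t, ht⟩⟩ := (hK.commonFace_eq_some_iff _ _ f).1 hf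
  have hng := not_gap_of_mem_outPairs hp
  obtain ⟨h1, h2⟩ := mem_of_mem_pairsOf (outPairs_subset o hp)
  have hs' := hS.sides_mem f hfH s
  have ht' := hS.sides_mem f hfH t
  rw [hs] at hs'; rw [ht] at ht'
  exact hng ⟨hs'.resolve_left (ho _ h1), ht'.resolve_left (ho _ h2)⟩

omit [DecidableEq F] in
/-- The sides of a face of `H` never form an outside arc. [folklore] -/
theorem side_side_not_mem_outPairs (hS : K.SubCx D H IntH BdH) {o : List E} (ho : ∀ e ∈ o, e ∉ IntH)
    {f : F} (hf : f ∈ H) (s t : Side) : (K.side f s, K.side f t) ∉ outPairs BdH o := by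
  intro hp
  obtain ⟨h1, h2⟩ := mem_of_mem_pairsOf (outPairs_subset o hp)
  exact not_gap_of_mem_outPairs hp ⟨(hS.sides_mem f hf s).resolve_left (ho _ h1),
    (hS.sides_mem f hf t).resolve_left (ho _ h2)⟩

omit [DecidableEq F] in
/-- The sides of a face outside `H` never form an inside arc (of an admissible family). [folklore] -/
theorem side_side_not_mem_insidePairs (hS : K.SubCx D H IntH BdH) (hK : K.Lawful) {o : List E}
    {κ : List (List E)} (hκ : ∀ b ∈ κ, ∀ e ∈ b, e ∈ IntH)
    (harc : ∀ p ∈ insidePairs (gaps BdH o) κ, ∃ f, K.arcFace p = some f) {f : F} (hf : f ∉ H)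
    (s t : Side) : (K.side f s, K.side f t) ∉ insidePairs (gaps BdH o) κ := by
  intro hp
  obtain ⟨g, hg⟩ := harc _ hp
  have hgH := mem_H_of_insidePair hS hK hκ hp hg
  rw [hK.eq_of_arcFace_of_sides hg (s := s) (t := t) rfl rfl] at hf
  exact hf hgH

omit [DecidableEq F] [DecidableEq E] in
/-- An inside run has at least two edges. [folklore] -/
theorem pairsOf_run_ne_nil (x y : E) (b : List E) : pairsOf (x :: (b ++ [y])) ≠ [] := by
  cases b <;> simp

omit [DecidableEq F] [DecidableEq E] in
/-- The first arc of an inside run starts at its first boundary edge. [folklore] -/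
theorem head?_pairsOf_run (x y : E) (b : List E) :
    ∃ v, (pairsOf (x :: (b ++ [y]))).head? = some (x, v) := by
  cases b <;> simp

omit [DecidableEq F] [DecidableEq E] in
/-- The last arc of an inside run ends at its last boundary edge. [folklore] -/
theorem getLast?_pairsOf_run (x y : E) (b : List E) :
    ∃ u, (pairsOf (x :: (b ++ [y]))).getLast? = some (u, y) := by
  rw [← List.cons_append, pairsOf_append_singleton (List.cons_ne_nil _ _)]
  exact ⟨_, by rw [List.getLast?_append]; rfl⟩

omit [DecidableEq F] in
/-- **The chain condition of a filled skeleton splits** into the chain conditions of the inside runs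
and the `triple` condition on the skeleton (no two consecutive gaps, consecutive outside arcs in
different faces); the mixed junctions are automatic since inside arcs lie in faces of `H` and
outside arcs do not. [cite: GlazmanManolescu2019, Corollary 3.2 (proof)] -/
theorem isChain_pairsOf_fill_iff (hS : K.SubCx D H IntH BdH) (hK : K.Lawful) {o : List E}
    (ho : ∀ e ∈ o, e ∉ IntH) {κ : List (List E)} (hκ : ∀ b ∈ κ, ∀ e ∈ b, e ∈ IntH)
    (hlen : κ.length = (gaps BdH o).length)
    (harcO : ∀ p ∈ outPairs BdH o, ∃ f, K.arcFace p = some f)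
    (harcI : ∀ p ∈ insidePairs (gaps BdH o) κ, ∃ f, K.arcFace p = some f) :
    (pairsOf (fill BdH o κ)).IsChain (fun p q => K.arcFace p ≠ K.arcFace q) ↔
      (pairsOf o).IsChain (fun p q => ¬((p.1 ∈ BdH ∧ p.2 ∈ BdH) ∧ (q.1 ∈ BdH ∧ q.2 ∈ BdH)) ∧
        (¬(p.1 ∈ BdH ∧ p.2 ∈ BdH) → ¬(q.1 ∈ BdH ∧ q.2 ∈ BdH) → K.arcFace p ≠ K.arcFace q)) ∧
      ∀ r ∈ insideRuns (gaps BdH o) κ, (pairsOf r).IsChain fun p q => K.arcFace p ≠ K.arcFace q := by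
  induction o generalizing κ with
  | nil => simp
  | cons e o ih =>
    cases o with
    | nil =>
      obtain rfl : κ = [] := List.eq_nil_of_length_eq_zero (by simpa using hlen)
      simp [insideRuns]
    | cons e' o =>
      have ho' : ∀ x ∈ e' :: o, x ∉ IntH := fun x hx => ho x (List.mem_cons_of_mem _ hx)
      -- the face facts at `e'`: two arcs in faces of `H` at the boundary edge `e'` coincide
      have hbd : ∀ (u v : E) (f₁ f₂ : F), e' ∈ BdH → K.arcFace (u, e') = some f₁ → f₁ ∈ H →
          K.arcFace (e', v) = some f₂ → f₂ ∈ H → f₁ = f₂ := by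
        intro u v f₁ f₂ he' h₁ hf₁ h₂ hf₂
        obtain ⟨-, -, ⟨t, ht⟩⟩ := (hK.commonFace_eq_some_iff _ _ f₁).1 h₁
        obtain ⟨-, ⟨s, hs⟩, -⟩ := (hK.commonFace_eq_some_iff _ _ f₂).1 h₂
        exact hS.bd_unique e' he' f₁ hf₁ f₂ hf₂ ⟨t, ht⟩ ⟨s, hs⟩
      rw [pairsOf_fill, runs_cons_cons]
      by_cases hg : e ∈ BdH ∧ e' ∈ BdH
      · -- first segment: the inside run `e :: b ++ [e']`
        obtain ⟨b, κ', rfl, hlen'⟩ := exists_cons_of_length_eq_gaps hg hlen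
        have hκ' : ∀ b' ∈ κ', ∀ x ∈ b', x ∈ IntH := fun b' hb' => hκ b' (List.mem_cons_of_mem _ hb')
        have hgaps : gaps BdH (e :: e' :: o) = (e, e') :: gaps BdH (e' :: o) := by rw [gaps_cons_cons, if_pos hg]
        rw [hgaps, insidePairs_cons] at harcI
        rw [if_pos hg, List.headD_cons, List.tail_cons, List.flatMap_cons, ← pairsOf_fill, List.isChain_append,
          hgaps, insideRuns_cons]
        rw [outPairs_cons_cons, if_pos hg] at harcO
        rw [ih ho' hκ' hlen' harcO fun p hp => harcI p (List.mem_append_right _ hp)]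
        simp only [List.mem_cons, forall_eq_or_imp, pairsOf_cons_cons]
        -- the junction at `e'`
        cases o with
        | nil =>
          obtain rfl : κ' = [] := List.eq_nil_of_length_eq_zero (by simpa using hlen')
          simp [insideRuns]
        | cons e'' o =>
          rw [pairsOf_cons_cons e' e'' o, List.isChain_cons_cons]
          by_cases hg' : e' ∈ BdH ∧ e'' ∈ BdH
          · -- two consecutive gaps: both sides are false
            obtain ⟨b₂, κ'', rfl, -⟩ := exists_cons_of_length_eq_gaps hg' hlen'
            have hgaps' : gaps BdH (e' :: e'' :: o) = (e', e'') :: gaps BdH (e'' :: o) := by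
              rw [gaps_cons_cons, if_pos hg']
            obtain ⟨u, hu⟩ := getLast?_pairsOf_run e e' b
            obtain ⟨v, hv⟩ := head?_pairsOf_run e' e'' b₂
            have hhead : (pairsOf (fill BdH (e' :: e'' :: o) (b₂ :: κ''))).head? = some (e', v) := by
              rw [pairsOf_fill, runs_cons_cons, if_pos hg', List.headD_cons, List.flatMap_cons,
                List.head?_append_of_ne_nil _ (pairsOf_run_ne_nil _ _ _), hv]
            have h1 : (u, e') ∈ insidePairs (gaps BdH (e :: e' :: e'' :: o)) (b :: b₂ :: κ'') := by
              rw [hgaps, insidePairs_cons]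
              exact List.mem_append_left _ (List.mem_of_getLast? hu)
            have h2 : (e', v) ∈ insidePairs (gaps BdH (e :: e' :: e'' :: o)) (b :: b₂ :: κ'') := by
              rw [hgaps, insidePairs_cons, hgaps', insidePairs_cons]
              exact List.mem_append_right _ (List.mem_append_left _ (List.mem_of_head? hv))
            rw [hgaps, insidePairs_cons] at h1 h2
            obtain ⟨f₁, hf₁⟩ := harcI _ h1
            obtain ⟨f₂, hf₂⟩ := harcI _ h2
            have hf₁H := mem_H_of_insidePair hS hK hκ (by rw [hgaps, insidePairs_cons]; exact h1) hf₁
            have hf₂H := mem_H_of_insidePair hS hK hκ (by rw [hgaps, insidePairs_cons]; exact h2) hf₂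
            have heq := hbd u v f₁ f₂ hg.2 hf₁ hf₁H hf₂ hf₂H
            subst heq
            have hJ : ¬∀ x ∈ (pairsOf (e :: (b ++ [e']))).getLast?,
                ∀ y ∈ (pairsOf (fill BdH (e' :: e'' :: o) (b₂ :: κ''))).head?, K.arcFace x ≠ K.arcFace y :=
              fun hj => hj _ (Option.mem_def.mpr hu) _ (Option.mem_def.mpr hhead) (hf₁.trans hf₂.symm)
            have hX : ¬(¬(((e, e').1 ∈ BdH ∧ (e, e').2 ∈ BdH) ∧ ((e', e'').1 ∈ BdH ∧ (e', e'').2 ∈ BdH)) ∧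
                (¬((e, e').1 ∈ BdH ∧ (e, e').2 ∈ BdH) → ¬((e', e'').1 ∈ BdH ∧ (e', e'').2 ∈ BdH) →
                  K.arcFace (e, e') ≠ K.arcFace (e', e''))) := fun h => h.1 ⟨hg, hg'⟩
            tauto
          · -- gap then outside arc: the junction is automatic
            have hgaps' : gaps BdH (e' :: e'' :: o) = gaps BdH (e'' :: o) := by rw [gaps_cons_cons, if_neg hg']
            obtain ⟨t, ht⟩ := fill_cons (BdH := BdH) e'' o κ'
            have hhead : (pairsOf (fill BdH (e' :: e'' :: o) κ')).head? = some (e', e'') := by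
              rw [fill_cons_cons, if_neg hg', ht]; rfl
            obtain ⟨u, hu⟩ := getLast?_pairsOf_run e e' b
            have h1 : (u, e') ∈ pairsOf (e :: (b ++ [e'])) := List.mem_of_getLast? hu
            obtain ⟨f₁, hf₁⟩ := harcI _ (List.mem_append_left _ h1)
            have hf₁H := mem_H_of_insidePair hS hK hκ (by rw [hgaps, insidePairs_cons]; exact List.mem_append_left _ h1) hf₁
            have h2 : (e', e'') ∈ outPairs BdH (e' :: e'' :: o) := by
              rw [outPairs_cons_cons, if_neg hg']; exact List.mem_cons_self
            obtain ⟨f₂, hf₂⟩ := harcO _ h2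
            have hf₂H := not_mem_H_of_outPair hS hK ho' h2 hf₂
            have hne : K.arcFace (u, e') ≠ K.arcFace (e', e'') := by
              rw [hf₁, hf₂]; exact fun h => hf₂H (Option.some_injective _ h ▸ hf₁H)
            have hJ : ∀ x ∈ (pairsOf (e :: (b ++ [e']))).getLast?,
                ∀ y ∈ (pairsOf (fill BdH (e' :: e'' :: o) κ')).head?, K.arcFace x ≠ K.arcFace y := by
              intro x hx y hy
              rw [hu] at hx; rw [hhead] at hy
              obtain rfl : (u, e') = x := by simpa using hx
              obtain rfl : (e', e'') = y := by simpa using hy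
              exact hne
            have hX : ¬(((e, e').1 ∈ BdH ∧ (e, e').2 ∈ BdH) ∧ ((e', e'').1 ∈ BdH ∧ (e', e'').2 ∈ BdH)) ∧
                (¬((e, e').1 ∈ BdH ∧ (e, e').2 ∈ BdH) → ¬((e', e'').1 ∈ BdH ∧ (e', e'').2 ∈ BdH) →
                  K.arcFace (e, e') ≠ K.arcFace (e', e'')) := ⟨fun h => hg' h.2, fun h => absurd hg h⟩
            tauto
      · -- first segment: the outside arc `(e, e')`
        have hgaps : gaps BdH (e :: e' :: o) = gaps BdH (e' :: o) := by rw [gaps_cons_cons, if_neg hg]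
        rw [hgaps] at hlen harcI
        rw [outPairs_cons_cons, if_neg hg] at harcO
        rw [if_neg hg, List.flatMap_cons, ← pairsOf_fill, List.isChain_append, hgaps,
          ih ho' hκ hlen (fun p hp => harcO p (List.mem_cons_of_mem _ hp)) harcI]
        simp only [pairsOf_cons_cons, pairsOf_singleton, List.isChain_singleton, true_and]
        cases o with
        | nil =>
          obtain rfl : κ = [] := List.eq_nil_of_length_eq_zero (by simpa using hlen)
          simp [insideRuns]
        | cons e'' o =>
          rw [pairsOf_cons_cons e' e'' o, List.isChain_cons_cons]
          obtain ⟨f₁, hf₁⟩ := harcO (e, e') List.mem_cons_self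
          have hf₁H := not_mem_H_of_outPair hS hK ho (by rw [outPairs_cons_cons, if_neg hg]; exact List.mem_cons_self) hf₁
          by_cases hg' : e' ∈ BdH ∧ e'' ∈ BdH
          · -- outside arc then gap: automatic junction
            obtain ⟨b₂, κ'', rfl, -⟩ := exists_cons_of_length_eq_gaps hg' hlen
            have hgaps' : gaps BdH (e' :: e'' :: o) = (e', e'') :: gaps BdH (e'' :: o) := by
              rw [gaps_cons_cons, if_pos hg']
            obtain ⟨v, hv⟩ := head?_pairsOf_run e' e'' b₂
            have hhead : (pairsOf (fill BdH (e' :: e'' :: o) (b₂ :: κ''))).head? = some (e', v) := by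
              rw [pairsOf_fill, runs_cons_cons, if_pos hg', List.headD_cons, List.flatMap_cons,
                List.head?_append_of_ne_nil _ (pairsOf_run_ne_nil _ _ _), hv]
            have h2 : (e', v) ∈ insidePairs (gaps BdH (e' :: e'' :: o)) (b₂ :: κ'') := by
              rw [hgaps', insidePairs_cons]
              exact List.mem_append_left _ (List.mem_of_head? hv)
            obtain ⟨f₂, hf₂⟩ := harcI _ h2
            have hf₂H := mem_H_of_insidePair hS hK hκ h2 hf₂
            have hne : K.arcFace (e, e') ≠ K.arcFace (e', v) := by
              rw [hf₁, hf₂]; exact fun h => hf₁H (Option.some_injective _ h ▸ hf₂H)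
            have hJ : ∀ x ∈ [(e, e')].getLast?,
                ∀ y ∈ (pairsOf (fill BdH (e' :: e'' :: o) (b₂ :: κ''))).head?, K.arcFace x ≠ K.arcFace y := by
              intro x hx y hy
              rw [hhead] at hy
              obtain rfl : (e, e') = x := by simpa using hx
              obtain rfl : (e', v) = y := by simpa using hy
              exact hne
            have hX : ¬(((e, e').1 ∈ BdH ∧ (e, e').2 ∈ BdH) ∧ ((e', e'').1 ∈ BdH ∧ (e', e'').2 ∈ BdH)) ∧
                (¬((e, e').1 ∈ BdH ∧ (e, e').2 ∈ BdH) → ¬((e', e'').1 ∈ BdH ∧ (e', e'').2 ∈ BdH) →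
                  K.arcFace (e, e') ≠ K.arcFace (e', e'')) := ⟨fun h => hg h.1, fun _ h => absurd hg' h⟩
            tauto
          · -- two outside arcs
            obtain ⟨t, ht⟩ := fill_cons (BdH := BdH) e'' o κ
            have hhead : (pairsOf (fill BdH (e' :: e'' :: o) κ)).head? = some (e', e'') := by
              rw [fill_cons_cons, if_neg hg', ht]; rfl
            have hJ : (∀ x ∈ [(e, e')].getLast?,
                ∀ y ∈ (pairsOf (fill BdH (e' :: e'' :: o) κ)).head?, K.arcFace x ≠ K.arcFace y) ↔
                K.arcFace (e, e') ≠ K.arcFace (e', e'') := by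
              constructor
              · exact fun h => h _ (by simp) _ (Option.mem_def.mpr hhead)
              · intro h x hx y hy
                rw [hhead] at hy
                obtain rfl : (e, e') = x := by simpa using hx
                obtain rfl : (e', e'') = y := by simpa using hy
                exact h
            have hX : (¬(((e, e').1 ∈ BdH ∧ (e, e').2 ∈ BdH) ∧ ((e', e'').1 ∈ BdH ∧ (e', e'').2 ∈ BdH)) ∧
                (¬((e, e').1 ∈ BdH ∧ (e, e').2 ∈ BdH) → ¬((e', e'').1 ∈ BdH ∧ (e', e'').2 ∈ BdH) →
                  K.arcFace (e, e') ≠ K.arcFace (e', e''))) ↔ K.arcFace (e, e') ≠ K.arcFace (e', e'') :=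
              ⟨fun h => h.2 hg hg', fun h => ⟨fun h' => hg h'.1, fun _ _ => h⟩⟩
            rw [hJ, hX]
            tauto

/-- **Validity of a filled skeleton splits into the outside condition on the skeleton and the local
condition on the family.** [cite: GlazmanManolescu2019, Corollary 3.2 (proof: "first sum over all
possible configurations outside H … then over those inside H")] -/
theorem isWalk_fill_iff (hS : K.SubCx D H IntH BdH) (hK : K.Lawful) {a z : E} {o : List E}
    (ho : ∀ e ∈ o, e ∉ IntH) {κ : List (List E)} (hκ : ∀ b ∈ κ, ∀ e ∈ b, e ∈ IntH)
    (hlen : κ.length = (gaps BdH o).length) :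
    K.IsWalk D a z (fill BdH o κ) ↔ K.OutValid D H IntH BdH a z o ∧ K.LocValid H IntH (gaps BdH o) κ := by
  have toOut : ∀ p, p ∈ outPairs BdH o → p ∈ pairsOf (fill BdH o κ) :=
    fun p h => (mem_pairsOf_fill_iff hlen).2 (Or.inl h)
  have toIn : ∀ p, p ∈ insidePairs (gaps BdH o) κ → p ∈ pairsOf (fill BdH o κ) :=
    fun p h => (mem_pairsOf_fill_iff hlen).2 (Or.inr h)
  constructor
  · intro W
    have harcO : ∀ p ∈ outPairs BdH o, ∃ f ∈ D, f ∉ H ∧ K.arcFace p = some f := fun p hp => by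
      obtain ⟨f, hfD, hf⟩ := W.arc_mem p (toOut p hp)
      exact ⟨f, hfD, not_mem_H_of_outPair hS hK ho hp hf, hf⟩
    have harcI : ∀ p ∈ insidePairs (gaps BdH o) κ, ∃ f ∈ H, K.arcFace p = some f := fun p hp => by
      obtain ⟨f, -, hf⟩ := W.arc_mem p (toIn p hp)
      exact ⟨f, mem_H_of_insidePair hS hK hκ hp hf, hf⟩
    have harcI' : ∀ p ∈ insidePairs (gaps BdH o) κ, ∃ f, K.arcFace p = some f :=
      fun p hp => (harcI p hp).imp fun f h => h.2
    have hchain := (isChain_pairsOf_fill_iff hS hK ho hκ hlen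
      (fun p hp => (harcO p hp).imp fun f h => h.2.2) harcI').1 W.isChain
    have hnd : (o ++ κ.flatten).Nodup := (fill_perm hlen).nodup_iff.1 W.nodup
    rw [List.nodup_append] at hnd
    refine ⟨⟨?_, ?_, hnd.1, ho, harcO, hchain.1, ?_⟩, ⟨hlen, hκ, hnd.2.1, harcI, hchain.2, ?_⟩⟩
    · rw [← head?_fill (BdH := BdH) o κ]; exact W.head_eq
    · rw [← getLast?_fill (BdH := BdH) o κ]; exact W.getLast_eq
    · intro f _ hWE hSN
      exact W.noncross f (hWE.imp (toOut _) (toOut _)) (hSN.imp (toOut _) (toOut _))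
    · intro f _ hWE hSN
      exact W.noncross f (hWE.imp (toIn _) (toIn _)) (hSN.imp (toIn _) (toIn _))
  · rintro ⟨OV, LV⟩
    have harcI' : ∀ p ∈ insidePairs (gaps BdH o) κ, ∃ f, K.arcFace p = some f :=
      fun p hp => (LV.arc_mem p hp).imp fun f h => h.2
    exact
      { head_eq := by rw [head?_fill]; exact OV.head_eq
        getLast_eq := by rw [getLast?_fill]; exact OV.getLast_eq
        nodup := by
          refine (fill_perm hlen).nodup_iff.2 (List.nodup_append.2 ⟨OV.nodup, LV.nodup, ?_⟩)
          intro x hx y hy hxy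
          subst hxy
          obtain ⟨b, hb, hxb⟩ := List.mem_flatten.1 hy
          exact OV.not_mem x hx (LV.subset b hb x hxb)
        arc_mem := fun p hp => by
          rcases (mem_pairsOf_fill_iff hlen).1 hp with h | h
          · obtain ⟨f, hfD, -, hf⟩ := OV.arc_mem p h
            exact ⟨f, hfD, hf⟩
          · obtain ⟨f, hfH, hf⟩ := LV.arc_mem p h
            exact ⟨f, hS.subset f hfH, hf⟩
        isChain := (isChain_pairsOf_fill_iff hS hK OV.not_mem LV.subset hlen
          (fun p hp => (OV.arc_mem p hp).imp fun f h => h.2.2) harcI').2 ⟨OV.triple, LV.isChain⟩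
        noncross := fun f hWE hSN => by
          by_cases hf : f ∈ H
          · have bk : ∀ s t, (K.side f s, K.side f t) ∈ pairsOf (fill BdH o κ) →
                (K.side f s, K.side f t) ∈ insidePairs (gaps BdH o) κ := fun s t h =>
              ((mem_pairsOf_fill_iff hlen).1 h).resolve_left (side_side_not_mem_outPairs hS OV.not_mem hf s t)
            exact LV.noncross f hf (hWE.imp (bk _ _) (bk _ _)) (hSN.imp (bk _ _) (bk _ _))
          · have bk : ∀ s t, (K.side f s, K.side f t) ∈ pairsOf (fill BdH o κ) →
                (K.side f s, K.side f t) ∈ outPairs BdH o := fun s t h =>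
              ((mem_pairsOf_fill_iff hlen).1 h).resolve_right
                (side_side_not_mem_insidePairs hS hK LV.subset harcI' hf s t)
            exact OV.noncross f hf (hWE.imp (bk _ _) (bk _ _)) (hSN.imp (bk _ _) (bk _ _)) }

/-! ### Factorisation of the weight -/

variable (K BdH)

/-- The faces of the outside arcs of a skeleton. [cite: GlazmanManolescu2019, Corollary 3.2 (proof)] -/
def outFaces (o : List E) : Finset F := ((outPairs BdH o).filterMap K.arcFace).toFinset

/-- The kinds of the outside arcs in the face `f`, in order. [cite: GlazmanManolescu2019, Corollary 3.2 (proof)] -/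
def kindsOut (o : List E) (f : F) : List ArcKind :=
  (outPairs BdH o).filterMap fun p => if K.arcFace p = some f then K.arcKindOf p else none

/-- **The outside weight of a skeleton**: the product of the local weights of the faces outside `H`
("the outside weights are equal in `Ω` and `Ω'`"). [cite: GlazmanManolescu2019, Corollary 3.2 (proof)] -/
def wOut (o : List E) : ℝ := ∏ f ∈ K.outFaces BdH o, localWeight (K.angle f) (K.kindsOut BdH o f)

variable {K BdH}

/-- **The weight of a filled skeleton factorises** into the outside weight of the skeleton and the
weight of the family inside `H`. [cite: GlazmanManolescu2019, Corollary 3.2 (proof)] -/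
theorem weight_fill {o : List E} {κ : List (List E)} (hlen : κ.length = (gaps BdH o).length)
    (harcO : ∀ p ∈ outPairs BdH o, ∃ f, f ∉ H ∧ K.arcFace p = some f)
    (harcI : ∀ p ∈ insidePairs (gaps BdH o) κ, ∃ f ∈ H, K.arcFace p = some f) :
    K.weight (fill BdH o κ) = K.wOut BdH o * K.wLoc H (gaps BdH o) κ := by
  set inF : Finset F := ((insidePairs (gaps BdH o) κ).filterMap K.arcFace).toFinset with hinF
  have hfaces : K.facesOf (fill BdH o κ) = K.outFaces BdH o ∪ inF := by
    ext f
    simp only [facesOf, outFaces, hinF, List.mem_toFinset, List.mem_filterMap, Finset.mem_union,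
      mem_pairsOf_fill_iff hlen]
    constructor
    · rintro ⟨p, hp | hp, hpf⟩
      exacts [Or.inl ⟨p, hp, hpf⟩, Or.inr ⟨p, hp, hpf⟩]
    · rintro (⟨p, hp, hpf⟩ | ⟨p, hp, hpf⟩)
      exacts [⟨p, Or.inl hp, hpf⟩, ⟨p, Or.inr hp, hpf⟩]
  have houtH : ∀ f ∈ K.outFaces BdH o, f ∉ H := by
    intro f hf
    obtain ⟨p, hp, hpf⟩ := List.mem_filterMap.1 (List.mem_toFinset.1 hf)
    obtain ⟨g, hg, hpg⟩ := harcO p hp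
    rw [hpg] at hpf
    cases hpf
    exact hg
  have hinH : ∀ f ∈ inF, f ∈ H := by
    intro f hf
    obtain ⟨p, hp, hpf⟩ := List.mem_filterMap.1 (List.mem_toFinset.1 hf)
    obtain ⟨g, hg, hpg⟩ := harcI p hp
    rw [hpg] at hpf
    cases hpf
    exact hg
  have hdisj : Disjoint (K.outFaces BdH o) inF :=
    Finset.disjoint_left.2 fun f h1 h2 => houtH f h1 (hinH f h2)
  -- the kinds in the outside faces and in the faces of `H`
  have hkO : ∀ f, f ∉ H → K.kindsIn (fill BdH o κ) f = K.kindsOut BdH o f := by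
    intro f hf
    unfold kindsIn kindsOut
    refine filterMap_pairsOf_fill_of_inside_eq_none _ hlen fun p hp => ?_
    obtain ⟨g, hg, hpg⟩ := harcI p hp
    rw [hpg, if_neg]
    exact fun h => hf (Option.some_injective _ h ▸ hg)
  have hkI : ∀ f ∈ H, K.kindsIn (fill BdH o κ) f = K.kindsLoc (gaps BdH o) κ f := by
    intro f hf
    unfold kindsIn kindsLoc
    refine filterMap_pairsOf_fill_of_outside_eq_none _ hlen fun p hp => ?_
    obtain ⟨g, hg, hpg⟩ := harcO p hp
    rw [hpg, if_neg]
    exact fun h => hg (Option.some_injective _ h ▸ hf)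
  rw [weight, hfaces, Finset.prod_union hdisj, wOut, wLoc]
  congr 1
  · exact Finset.prod_congr rfl fun f hf => by rw [hkO f (houtH f hf)]
  · rw [Finset.prod_congr rfl fun f hf => by rw [hkI f (hinH f hf)]]
    refine Finset.prod_subset (fun f hf => hinH f hf) fun f hfH hfn => ?_
    have : K.kindsLoc (gaps BdH o) κ f = [] := List.filterMap_eq_nil_iff.2 fun p hp => by
      obtain ⟨g, -, hpg⟩ := harcI p hp
      rw [hpg, if_neg]
      intro h
      cases h
      exact hfn (List.mem_toFinset.2 (List.mem_filterMap.2 ⟨p, hp, hpg⟩))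
    rw [this, localWeight_nil]

/-! ### The sum over a fibre, and the sum over skeletons -/

omit [DecidableEq F] [DecidableEq E] in
/-- In a walk, interior edges are only adjacent to interior or boundary edges. [folklore] -/
theorem adj_of_isWalk (hS : K.SubCx D H IntH BdH) (hK : K.Lawful) {a z : E} {m : List E}
    (hm : K.IsWalk D a z m) {p : E × E} (hp : p ∈ pairsOf m) :
    (p.1 ∈ IntH → p.2 ∈ IntH ∨ p.2 ∈ BdH) ∧ (p.2 ∈ IntH → p.1 ∈ IntH ∨ p.1 ∈ BdH) := by
  obtain ⟨f, -, hf⟩ := hm.arc_mem p hp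
  obtain ⟨s, t, -, hs, ht, -⟩ := hK.exists_sides_of_arcFace hf
  constructor
  · intro h1
    have hfH := hS.int_faces _ h1 f s hs
    rw [← ht]; exact hS.sides_mem f hfH t
  · intro h2
    have hfH := hS.int_faces _ h2 f t ht
    rw [← hs]; exact hS.sides_mem f hfH s

omit [DecidableEq F] in
/-- **Every walk is a filled skeleton**, with a locally admissible family. [cite: GlazmanManolescu2019, Corollary 3.2 (proof)] -/
theorem exists_fill_skel_eq (hS : K.SubCx D H IntH BdH) (hK : K.Lawful) {a z : E} (ha : a ∉ IntH) (hz : z ∉ IntH)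
    {m : List E} (hm : K.IsWalk D a z m) :
    ∃ κ : List (List E), κ.length = (gaps BdH (skel IntH m)).length ∧ (∀ b ∈ κ, ∀ e ∈ b, e ∈ IntH) ∧
      fill BdH (skel IntH m) κ = m :=
  exists_fill_eq m.length m le_rfl
    (fun e he => by rw [hm.head_eq, Option.some.injEq] at he; exact he ▸ ha)
    (fun e he => by rw [hm.getLast_eq, Option.some.injEq] at he; exact he ▸ hz)
    (fun p hp => adj_of_isWalk hS hK hm hp)

/-- The skeleton avoids the interior edges. [folklore] -/
theorem not_mem_of_mem_skel {m : List E} {e : E} (he : e ∈ skel IntH m) : e ∉ IntH := by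
  simpa using (List.mem_filter.1 he).2

open Classical in
/-- **The fibre of a skeleton**: the walks with skeleton `o` weigh `w_out(o) · Z_H(gaps o)` in total
if `o` satisfies the outside condition, and nothing otherwise.
[cite: GlazmanManolescu2019, Corollary 3.2 (proof: the double sum)] -/
theorem sum_fibre_eq (hS : K.SubCx D H IntH BdH) (hK : K.Lawful) (hD : D.Finite) {a z : E} (ha : a ∉ IntH)
    (hz : z ∉ IntH) (o : List E) :
    ∑ m ∈ (K.walkFinset D a z).filter (fun m => skel IntH m = o), K.weight m =
      if K.OutValid D H IntH BdH a z o then K.wOut BdH o * K.Zloc H IntH (gaps BdH o) else 0 := by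
  have hfin := K.walkSet_finite hK hD a z
  split_ifs with hOV
  · have himage : (K.walkFinset D a z).filter (fun m => skel IntH m = o) =
        (K.locSol H IntH (gaps BdH o)).image (fill BdH o) := by
      ext m
      rw [Finset.mem_filter, K.mem_walkFinset hfin, Finset.mem_image]
      constructor
      · rintro ⟨hm, rfl⟩
        obtain ⟨κ, hlen, hκ, hfill⟩ := exists_fill_skel_eq hS hK ha hz hm
        refine ⟨κ, (K.mem_locSol).2 ?_, hfill⟩
        rw [← hfill] at hm
        exact ((isWalk_fill_iff hS hK (fun e he => not_mem_of_mem_skel he) hκ hlen).1 hm).2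
      · rintro ⟨κ, hκ, rfl⟩
        have LV := (K.mem_locSol).1 hκ
        exact ⟨(isWalk_fill_iff hS hK hOV.not_mem LV.subset LV.length_eq).2 ⟨hOV, LV⟩,
          skel_fill hOV.not_mem LV.subset LV.length_eq⟩
    rw [himage, Finset.sum_image, Zloc, Finset.mul_sum]
    · refine Finset.sum_congr rfl fun κ hκ => ?_
      have LV := (K.mem_locSol).1 hκ
      exact weight_fill LV.length_eq (fun p hp => (hOV.arc_mem p hp).imp fun f h => h.2) LV.arc_mem
    · intro κ₁ h₁ κ₂ h₂ h
      have L₁ := (K.mem_locSol).1 h₁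
      have L₂ := (K.mem_locSol).1 h₂
      exact fill_injective hOV.not_mem L₁.subset L₁.length_eq L₂.subset L₂.length_eq h
  · refine Finset.sum_eq_zero fun m hm => ?_
    exfalso
    rw [Finset.mem_filter, K.mem_walkFinset hfin] at hm
    obtain ⟨hm, rfl⟩ := hm
    obtain ⟨κ, hlen, hκ, hfill⟩ := exists_fill_skel_eq hS hK ha hz hm
    rw [← hfill] at hm
    exact hOV ((isWalk_fill_iff hS hK (fun e he => not_mem_of_mem_skel he) hκ hlen).1 hm).1

open Classical in
/-- **`G_D(a, z)` as a sum over skeletons**: `Σ_{o} w_out(o) · Z_H(gaps o)` over the skeletons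
satisfying the outside condition (in any finite set containing the skeletons of the walks).
[cite: GlazmanManolescu2019, Corollary 3.2 (proof)] -/
theorem wsum_eq_sum_skel (hS : K.SubCx D H IntH BdH) (hK : K.Lawful) (hD : D.Finite) {a z : E} (ha : a ∉ IntH)
    (hz : z ∉ IntH) {O : Finset (List E)} (hO : ∀ m ∈ K.walkFinset D a z, skel IntH m ∈ O) :
    K.wsum D a z = ∑ o ∈ O, if K.OutValid D H IntH BdH a z o then K.wOut BdH o * K.Zloc H IntH (gaps BdH o) else 0 := by
  rw [wsum, ← Finset.sum_fiberwise_of_maps_to hO]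
  exact Finset.sum_congr rfl fun o _ => sum_fibre_eq hS hK hD ha hz o

/-! ### Corollary 3.2: complexes that agree outside `H` and have the same local partition functions -/

variable {K' : Cx F E}

/-- An outside arc has a component that is neither interior nor boundary. [folklore] -/
theorem exists_plain_of_mem_outPairs {o : List E} (ho : ∀ e ∈ o, e ∉ IntH) {p : E × E}
    (hp : p ∈ outPairs BdH o) : ∃ c, (c = p.1 ∨ c = p.2) ∧ c ∉ IntH ∧ c ∉ BdH := by
  obtain ⟨h1, h2⟩ := mem_of_mem_pairsOf (outPairs_subset o hp)
  have hng := not_gap_of_mem_outPairs hp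
  by_cases hb : p.1 ∈ BdH
  · exact ⟨p.2, Or.inr rfl, ho _ h2, fun h => hng ⟨hb, h⟩⟩
  · exact ⟨p.1, Or.inl rfl, ho _ h1, hb⟩

omit [DecidableEq F] in
/-- **Complexes that agree outside `H` draw the outside arcs in the same faces.** [cite: GlazmanManolescu2019, Corollary 3.2 (proof)] -/
theorem arcFace_eq_of_agree (hS : K.SubCx D H IntH BdH) (hS' : K'.SubCx D H IntH BdH) (hK : K.Lawful)
    (hK' : K'.Lawful) (hside : ∀ f ∉ H, ∀ s, K'.side f s = K.side f s) {o : List E}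
    (ho : ∀ e ∈ o, e ∉ IntH) {p : E × E} (hp : p ∈ outPairs BdH o) : K'.arcFace p = K.arcFace p := by
  obtain ⟨c, hc, hcI, hcB⟩ := exists_plain_of_mem_outPairs ho hp
  -- a face of which `c` is a side is not in `H`, in either complex
  have key : ∀ (L : Cx F E), L.SubCx D H IntH BdH → ∀ f s, L.side f s = c → f ∉ H := by
    intro L hL f s hs hf
    rcases hL.sides_mem f hf s with h | h
    · exact hcI (hs ▸ h)
    · exact hcB (hs ▸ h)
  have key' : ∀ (L : Cx F E), L.SubCx D H IntH BdH → ∀ f, (∃ s, L.side f s = p.1) → (∃ t, L.side f t = p.2) → f ∉ H := by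
    intro L hL f hs ht
    rcases hc with rfl | rfl
    · obtain ⟨s, hs⟩ := hs; exact key L hL f s hs
    · obtain ⟨t, ht⟩ := ht; exact key L hL f t ht
  ext f
  rw [arcFace, arcFace, hK'.commonFace_eq_some_iff, hK.commonFace_eq_some_iff]
  constructor
  · rintro ⟨hne, hs, ht⟩
    have hf := key' K' hS' f hs ht
    simp only [hside f hf] at hs ht
    exact ⟨hne, hs, ht⟩
  · rintro ⟨hne, hs, ht⟩
    have hf := key' K hS f hs ht
    simp only [← hside f hf] at hs ht
    exact ⟨hne, hs, ht⟩

omit [DecidableEq F] [DecidableEq E] in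
/-- `sideOf` agrees outside `H`. [folklore] -/
theorem sideOf_eq_of_agree (hK : K.Lawful) (hK' : K'.Lawful) (hside : ∀ f ∉ H, ∀ s, K'.side f s = K.side f s)
    {f : F} (hf : f ∉ H) (e : E) : K'.sideOf f e = K.sideOf f e := by
  ext s
  rw [hK'.sideOf_eq_some_iff, hK.sideOf_eq_some_iff, hside f hf]

omit [DecidableEq F] in
/-- Complexes that agree outside `H` give the outside arcs the same kinds. [folklore] -/
theorem arcKindOf_eq_of_agree (hS : K.SubCx D H IntH BdH) (hS' : K'.SubCx D H IntH BdH) (hK : K.Lawful)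
    (hK' : K'.Lawful) (hside : ∀ f ∉ H, ∀ s, K'.side f s = K.side f s) {o : List E}
    (ho : ∀ e ∈ o, e ∉ IntH) {p : E × E} (hp : p ∈ outPairs BdH o) : K'.arcKindOf p = K.arcKindOf p := by
  unfold arcKindOf
  rw [arcFace_eq_of_agree hS hS' hK hK' hside ho hp]
  rcases hf : K.arcFace p with _ | f
  · rfl
  · have hfH := not_mem_H_of_outPair hS hK ho hp hf
    simp only [Option.bind_some, sideOf_eq_of_agree hK hK' hside hfH]

omit [DecidableEq F] in
/-- **The outside condition does not depend on the complex inside `H`.** [cite: GlazmanManolescu2019, Corollary 3.2 (proof)] -/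
theorem OutValid.of_agree (hS : K.SubCx D H IntH BdH) (hS' : K'.SubCx D H IntH BdH) (hK : K.Lawful)
    (hK' : K'.Lawful) (hside : ∀ f ∉ H, ∀ s, K'.side f s = K.side f s) {a z : E} {o : List E}
    (h : K.OutValid D H IntH BdH a z o) : K'.OutValid D H IntH BdH a z o where
  head_eq := h.head_eq
  getLast_eq := h.getLast_eq
  nodup := h.nodup
  not_mem := h.not_mem
  arc_mem p hp := by
    obtain ⟨f, hfD, hfH, hf⟩ := h.arc_mem p hp
    exact ⟨f, hfD, hfH, (arcFace_eq_of_agree hS hS' hK hK' hside h.not_mem hp).trans hf⟩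
  triple := by
    have hout : ∀ p ∈ pairsOf o, ¬(p.1 ∈ BdH ∧ p.2 ∈ BdH) → p ∈ outPairs BdH o := fun p hp hng =>
      (mem_gaps_or_mem_outPairs hp).resolve_left fun h => hng (mem_of_mem_gaps h)
    have := isChain_map_of_mem (S := fun p q : E × E =>
        ¬((p.1 ∈ BdH ∧ p.2 ∈ BdH) ∧ (q.1 ∈ BdH ∧ q.2 ∈ BdH)) ∧
          (¬(p.1 ∈ BdH ∧ p.2 ∈ BdH) → ¬(q.1 ∈ BdH ∧ q.2 ∈ BdH) → K'.arcFace p ≠ K'.arcFace q))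
      id h.triple fun p hp q hq hpq => ⟨hpq.1, fun hnp hnq => by
        simp only [id, arcFace_eq_of_agree hS hS' hK hK' hside h.not_mem (hout p hp hnp),
          arcFace_eq_of_agree hS hS' hK hK' hside h.not_mem (hout q hq hnq)]
        exact hpq.2 hnp hnq⟩
    simpa using this
  noncross f hf := by
    simp only [hside f hf]
    exact h.noncross f hf

/-- **The outside weight does not depend on the complex inside `H`** ("the outside weights are
equal in `Ω` and `Ω'`"). [cite: GlazmanManolescu2019, Corollary 3.2 (proof)] -/
theorem wOut_eq_of_agree (hS : K.SubCx D H IntH BdH) (hS' : K'.SubCx D H IntH BdH) (hK : K.Lawful)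
    (hK' : K'.Lawful) (hside : ∀ f ∉ H, ∀ s, K'.side f s = K.side f s) (hangle : ∀ f ∉ H, K'.angle f = K.angle f)
    {o : List E} (ho : ∀ e ∈ o, e ∉ IntH) : K'.wOut BdH o = K.wOut BdH o := by
  have hF : K'.outFaces BdH o = K.outFaces BdH o := by
    unfold outFaces
    rw [filterMap_congr_of_mem fun p hp => arcFace_eq_of_agree hS hS' hK hK' hside ho hp]
  have hk : ∀ f, K'.kindsOut BdH o f = K.kindsOut BdH o f := fun f => by
    unfold kindsOut
    exact filterMap_congr_of_mem fun p hp => by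
      rw [arcFace_eq_of_agree hS hS' hK hK' hside ho hp, arcKindOf_eq_of_agree hS hS' hK hK' hside ho hp]
  rw [wOut, wOut, hF]
  refine Finset.prod_congr rfl fun f hf => ?_
  obtain ⟨p, hp, hpf⟩ := List.mem_filterMap.1 (List.mem_toFinset.1 hf)
  rw [hk f, hangle f (not_mem_H_of_outPair hS hK ho hp hpf)]

/-- **Corollary 3.2 (the substitution principle).** Two lawful complexes on the same faces and edges
that agree (sides and angles) outside a piece `H` — with the same interior and boundary edges — and
whose local partition functions `Z_H(P)` agree for every list of gaps `P` arising from a skeleton,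
have the same partition function `G_D(a, z)` between edges that are not interior to `H`: "for any
two vertices `a, b` of `Ω` that are not in `H ∖ ∂H`, `Σ_{γ ⊂ Ω: a → b} w_Ω(γ) = Σ_{γ ⊂ Ω': a → b} w_{Ω'}(γ)`".
[cite: GlazmanManolescu2019, Corollary 3.2] -/
theorem wsum_eq_of_Zloc_eq (hS : K.SubCx D H IntH BdH) (hS' : K'.SubCx D H IntH BdH) (hK : K.Lawful)
    (hK' : K'.Lawful) (hside : ∀ f ∉ H, ∀ s, K'.side f s = K.side f s) (hangle : ∀ f ∉ H, K'.angle f = K.angle f)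
    (hD : D.Finite) {a z : E} (ha : a ∉ IntH) (hz : z ∉ IntH)
    (hZ : ∀ o, K.OutValid D H IntH BdH a z o → K'.Zloc H IntH (gaps BdH o) = K.Zloc H IntH (gaps BdH o)) :
    K'.wsum D a z = K.wsum D a z := by
  classical
  set O : Finset (List E) := (K.walkFinset D a z).image (skel IntH) ∪ (K'.walkFinset D a z).image (skel IntH)
  rw [wsum_eq_sum_skel hS' hK' hD ha hz (O := O) fun m hm => Finset.mem_union_right _ (Finset.mem_image_of_mem _ hm),
    wsum_eq_sum_skel hS hK hD ha hz (O := O) fun m hm => Finset.mem_union_left _ (Finset.mem_image_of_mem _ hm)]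
  refine Finset.sum_congr rfl fun o _ => ?_
  by_cases hOV : K.OutValid D H IntH BdH a z o
  · rw [if_pos hOV, if_pos (hOV.of_agree hS hS' hK hK' hside), hZ o hOV,
      wOut_eq_of_agree hS hS' hK hK' hside hangle hOV.not_mem]
  · have hOV' : ¬K'.OutValid D H IntH BdH a z o := fun h =>
      hOV (h.of_agree hS' hS hK' hK fun f hf s => (hside f hf s).symm)
    rw [if_neg hOV, if_neg hOV']

end Split

end Gluing

end Cx

end Literature.Probability.RandomPlanarGeometry.SAW.YangBaxter
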